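import Summits.BirchSwinnertonDyer.Rank1Residual.ManinAdditive.CuspThreeTorsionAtFourEdges
import Summits.BirchSwinnertonDyer.Rank1Residual.ManinAdditive.HalfTranslationParity
import Summits.BirchSwinnertonDyer.BirchSwinnertonDyer.Theorems.ManinLocalTwoThreeAtkinLehnerSymbolShift
import Summits.BirchSwinnertonDyer.BirchSwinnertonDyer.Theorems.ManinLocalTwoThreeAdditiveDyadicTransport
import Literature.NumberTheory.EllipticCurves.AtkinLehnerInvolutionsNewformProofs
import Literature.NumberTheory.EllipticCurves.ModularSymbolsProofs
import HarnessLib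

/-!
# E-an-45 `CuspThreeTorsionAtFourExact` and E-an-83 `FourPCuspHexagon` hold: cusp `3`-torsion and the cusp hexagon at `4 ∥ N`

Summit `BirchSwinnertonDyer`, route `ManinLocalTwoThree` (cell bsd-f2-manin), deciding crux C2 `ManinOddAtFour`
(stmt-BirchSwinnertonDyer-22967); analytic lens (an g11 MEMO-an §55 «level-four sign package», an g18 MEMO-an §60.5
«THEOREM B»; refuter-1 §R46 / §R59: THEOREM-candidates by exact symbol calculus, NOT in print as statements).
PROVED HERE, unconditionally and for EITHER Atkin–Lehner sign `λ₄ = ±1` (E-an-44 is not used):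

* `cusp_relations_of_isNewform0_four_mul` — for a newform `f` on `Γ₀(4M)`, `M` odd, with `s_r = {∞, r}_f`:
  `2 s_{1/4} ∈ Λ_f`, `3 s_{1/M} ∈ Λ_f`, `s_0 − s_{1/4} − s_{1/M} ∈ Λ_f`, `s_{1/2} + s_0 ∈ Λ_f`,
  `s_{1/(2M)} + s_{1/M} ∈ Λ_f`;
* `cuspThreeTorsionAtFourExact_holds : CuspThreeTorsionAtFourExact` (E-an-45 BY NAME) and
  `cuspImageThreeTorsion_holds : CuspImageThreeTorsion` (E-an-45′, through the leaf's proved edge);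
* `fourPCuspHexagon_holds : HalfTranslation.FourPCuspHexagon` (E-an-83 = THEOREM B BY NAME; `M = p`).

THE ARGUMENT (exact relations, reduced mod `Λ_f`).  `w = w(4) = (4x, y; 4M, 4)` (`4x − My = 1`, `y` odd),
`w_4 f = ε f` (`ε = ±1`, `IsNewform0.exists_atkinLehnerInvolution_eq_smul`), `u = {∞, w∞}_f = {∞, x/M}_f`.
THREE-TERM relation (sibling tool `modularSymbol_atkinLehnerW_smul`): `{∞, w r} = ε{∞, r} + u` at `r = ½` and
`r = 0`; HALF-TRANSLATE (`{∞, r + ½} = −{∞, r}`, as `a_{2n}(f) = 0` at `4 ∣ N`); and five EXPLICIT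
`Γ₀(4M)`-equivalences of cusps (Manin's relation for the matrices `γ₁ … γ₅` in the proof): `x/M ~ 1/M`, `w(½) ~ ½`,
`w(0) = y/4 ~ ¼`, `¾ ~ ¼`, `(M+2)/(2M) ~ 1/(2M)`.  Mod `Λ_f`: `u ≡ s_{1/M}`, `u ≡ (1 − ε)s_{1/2} = −(1 − ε)s_0`,
`s_{1/4} ≡ ε s_0 + u`, `2 s_{1/4} ≡ 0`, `s_{1/(2M)} ≡ −s_{1/M}`; so for `ε = 1`: `s_{1/M} ≡ 0`, and for `ε = −1`:
`s_{1/M} ≡ −2 s_0`, `s_{1/4} ≡ −3 s_0 ≡ 3 s_0`, hence `6 s_0 ≡ 0` and `3 s_{1/M} ≡ 0`.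
Nothing about BSD, Manin's conjecture or any Manin constant is asserted or proved here (Manin-neutral rows, MEMO-an §55.5).
-/

-- `Summit.BirchSwinnertonDyer.BirchSwinnertonDyer` is the mandated summit-side namespace (single-conjunct summit).
set_option linter.dupNamespace false

noncomputable section

open scoped MatrixGroups ModularForm
open CongruenceSubgroup Matrix.SpecialLinearGroup
open Literature.NumberTheory.EllipticCurves Literature.NumberTheory.EllipticCurves.ModularForms
open Summit.BirchSwinnertonDyer.Rank1Residual.ManinAdditive
open Summit.BirchSwinnertonDyer.Rank1Residual.ManinAdditive.HalfTranslation

namespace Summit.BirchSwinnertonDyer.BirchSwinnertonDyer.Theorems.ManinLocalTwoThree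

/-- **Manin's relation as a lattice congruence**: for `γ = (a b; c d) ∈ Γ₀(N)` (`ad − bc = 1`, `N ∣ c`) and a cusp
`r` with `c r + d ≠ 0`, `{∞, γ r}_f − {∞, r}_f = {∞, γ∞}_f ∈ Λ_f`; the image cusp `s = γ r` enters through the
cross-multiplied identity `a r + b = s (c r + d)`. [cite: Manin1972, Prop. 1.4 and Thm. 1.6] -/
theorem modularSymbol_sub_mem_periodLattice_of_entries {N : ℕ} [NeZero N] (f : CuspForm (Gamma0 N) 2)
    {a b c d : ℤ} (hdet : a * d - b * c = 1) (hcN : (N : ℤ) ∣ c) (r s : ℚ)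
    (hr : (c : ℚ) * r + d ≠ 0) (hs : (a : ℚ) * r + b = s * ((c : ℚ) * r + d)) :
    modularSymbol f s - modularSymbol f r ∈ periodLattice f := by
  let γ : SL(2, ℤ) := ⟨!![a, b; c, d], by rw [Matrix.det_fin_two_of]; linear_combination hdet⟩
  have hγ : γ ∈ Gamma0 N := by
    rw [Gamma0_mem]
    show ((c : ℤ) : ZMod N) = 0
    exact (ZMod.intCast_zmod_eq_zero_iff_dvd c N).mpr hcN
  have key : modularSymbol f ((((a : ℤ) : ℚ) * r + ((b : ℤ) : ℚ)) / (((c : ℤ) : ℚ) * r + ((d : ℤ) : ℚ))) =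
      cuspSymbol f ⟨γ, hγ⟩ + modularSymbol f r :=
    modularSymbol_gamma0_smul_holds f ⟨γ, hγ⟩ r hr
  have hval : ((((a : ℤ) : ℚ) * r + ((b : ℤ) : ℚ)) / (((c : ℤ) : ℚ) * r + ((d : ℤ) : ℚ))) = s := by
    rw [hs, mul_div_cancel_right₀ _ hr]
  rw [hval] at key
  rw [key, add_sub_cancel_right]
  exact cuspSymbol_mem_periodLattice f ⟨γ, hγ⟩

/-- **Manin's relation for cusps given as fractions**: `γ = (a b; c d) ∈ Γ₀(N)` maps `rn/rd` to `sn/sd` when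
`(a·rn + b·rd)·sd = sn·(c·rn + d·rd)` (integers, `c·rn + d·rd ≠ 0`); then `{∞, sn/sd}_f − {∞, rn/rd}_f ∈ Λ_f`.
[cite: Manin1972, Prop. 1.4 and Thm. 1.6] -/
theorem modularSymbol_div_sub_div_mem_periodLattice {N : ℕ} [NeZero N] (f : CuspForm (Gamma0 N) 2)
    {a b c d : ℤ} (hdet : a * d - b * c = 1) (hcN : (N : ℤ) ∣ c) (rn rd sn sd : ℤ) (hrd : rd ≠ 0)
    (hsd : sd ≠ 0) (hden : c * rn + d * rd ≠ 0) (hid : (a * rn + b * rd) * sd = sn * (c * rn + d * rd)) :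
    modularSymbol f ((sn : ℚ) / sd) - modularSymbol f ((rn : ℚ) / rd) ∈ periodLattice f := by
  have hrd' : (rd : ℚ) ≠ 0 := by exact_mod_cast hrd
  have hsd' : (sd : ℚ) ≠ 0 := by exact_mod_cast hsd
  have hden' : (c : ℚ) * rn + d * rd ≠ 0 := by exact_mod_cast hden
  have hid' : ((a : ℚ) * rn + b * rd) * sd = sn * ((c : ℚ) * rn + d * rd) := by exact_mod_cast hid
  refine modularSymbol_sub_mem_periodLattice_of_entries f hdet hcN ((rn : ℚ) / rd) ((sn : ℚ) / sd) ?_ ?_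
  · have : (c : ℚ) * ((rn : ℚ) / rd) + d = ((c : ℚ) * rn + d * rd) / rd := by
      field_simp
    rw [this]
    exact div_ne_zero hden' hrd'
  · have h1 : (a : ℚ) * ((rn : ℚ) / rd) + b = ((a : ℚ) * rn + b * rd) / rd := by field_simp
    have h2 : (c : ℚ) * ((rn : ℚ) / rd) + d = ((c : ℚ) * rn + d * rd) / rd := by field_simp
    rw [h1, h2]
    field_simp
    linear_combination hid'


/-- **The five cusp relations at level `4M`, `M` odd** (module docstring): for a newform `f ∈ S₂(Γ₀(4M))`,
`2{∞,¼} ∈ Λ_f`, `3{∞,1/M} ∈ Λ_f`, `{∞,0} − {∞,¼} − {∞,1/M} ∈ Λ_f`, `{∞,½} + {∞,0} ∈ Λ_f`,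
`{∞,1/(2M)} + {∞,1/M} ∈ Λ_f` — Atkin–Lehner three-term relation at `w(4)` (`modularSymbol_atkinLehnerW_smul`), half-translate,
and five explicit `Γ₀(4M)`-matrices; valid for either sign `λ₄(f) = ±1`. [cite: Manin1972, Prop. 1.4] [cite: Knapp1993, Lemma 9.24 and Thm. 9.27] -/
theorem cusp_relations_of_isNewform0_four_mul {M : ℕ} [NeZero (4 * M)] (hM : Odd M)
    (f : CuspForm (Gamma0 (4 * M)) 2) (hf : IsNewform0 f) :
    (2 : ℂ) * modularSymbol f (1 / 4 : ℚ) ∈ periodLattice f ∧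
    3 * modularSymbol f (1 / (M : ℚ)) ∈ periodLattice f ∧
    modularSymbol f 0 - modularSymbol f (1 / 4 : ℚ) - modularSymbol f (1 / (M : ℚ)) ∈ periodLattice f ∧
    modularSymbol f (1 / 2 : ℚ) + modularSymbol f 0 ∈ periodLattice f ∧
    modularSymbol f (1 / (2 * M : ℚ)) + modularSymbol f (1 / (M : ℚ)) ∈ periodLattice f := by
  -- arithmetic of the level
  obtain ⟨m', hm'⟩ := hM
  have hMne : (M : ℤ) ≠ 0 := by omega
  have hMz : (M : ℤ) = 2 * m' + 1 := by exact_mod_cast hm'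
  have h4 : 4 ∣ 4 * M := dvd_mul_right 4 M
  have hdiv : 4 * M / 4 = M := Nat.mul_div_cancel_left M (by norm_num)
  have hcop : Nat.Coprime 4 (4 * M / 4) := by
    rw [hdiv]
    have h2 : Nat.Coprime 2 M := Nat.prime_two.coprime_iff_not_dvd.mpr (by omega)
    simpa using h2.pow_left 2
  have heven : ∀ n : ℕ, 2 ∣ n → cuspCoeff f n = 0 := fun n hn ↦
    Literature.NumberTheory.Automorphic.IsNewform0.cuspCoeff_eq_zero_of_two_dvd hf h4 hn
  have hN : ((4 * M : ℕ) : ℤ) = 4 * (M : ℤ) := by push_cast; ring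
  -- the Atkin–Lehner matrix `w(4) = (4x, y; 4M, 4)` and its sign
  set x : ℤ := atkinLehnerSL (4 * M) 4 0 0 with hx
  set y : ℤ := atkinLehnerSL (4 * M) 4 0 1 with hy
  have hbez : 4 * x - (M : ℤ) * y = 1 := by
    have h := atkinLehnerSL_bezout (4 * M) 4 hcop
    rw [hdiv] at h
    exact_mod_cast h
  have hyodd : Odd y := by
    have hMy : Odd ((M : ℤ) * y) := ⟨2 * x - 1, by linear_combination -hbez⟩
    exact (Int.odd_mul.mp hMy).2
  obtain ⟨y', hy'⟩ := hyodd
  have hbez' : 4 * x - (2 * (m' : ℤ) + 1) * (2 * y' + 1) = 1 := by rw [← hMz, ← hy']; exact hbez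
  obtain ⟨ε, hε1, hε⟩ := hf.exists_atkinLehnerInvolution_eq_smul h4 hcop
  -- cast identities for the cusps
  have q2 : (1 / 2 : ℚ) = ((1 : ℤ) : ℚ) / ((2 : ℤ) : ℚ) := by norm_num
  have q4 : (1 / 4 : ℚ) = ((1 : ℤ) : ℚ) / ((4 : ℤ) : ℚ) := by norm_num
  have q34 : (3 / 4 : ℚ) = ((3 : ℤ) : ℚ) / ((4 : ℤ) : ℚ) := by norm_num
  have qM : (1 / (M : ℚ)) = ((1 : ℤ) : ℚ) / ((M : ℤ) : ℚ) := by push_cast; ring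
  have q2M : (1 / (2 * M : ℚ)) = ((1 : ℤ) : ℚ) / ((2 * M : ℤ) : ℚ) := by push_cast; ring
  have qxM : ((x : ℚ) / (4 * M / 4 : ℕ)) = ((x : ℤ) : ℚ) / ((M : ℤ) : ℚ) := by rw [hdiv]; push_cast; ring
  have qW2 : ((((4 : ℕ) : ℚ) * (x : ℚ) * (1 / 2 : ℚ) + (y : ℚ)) / (((4 * M : ℕ) : ℚ) * (1 / 2 : ℚ) + ((4 : ℕ) : ℚ)))
      = ((2 * x + y : ℤ) : ℚ) / ((2 * M + 4 : ℤ) : ℚ) := by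
    have h0 : ((2 * M + 4 : ℤ) : ℚ) ≠ 0 := by positivity
    rw [div_eq_div_iff (by positivity) h0]
    push_cast
    ring
  have qW0 : ((((4 : ℕ) : ℚ) * (x : ℚ) * (0 : ℚ) + (y : ℚ)) / (((4 * M : ℕ) : ℚ) * (0 : ℚ) + ((4 : ℕ) : ℚ)))
      = ((y : ℤ) : ℚ) / ((4 : ℤ) : ℚ) := by
    push_cast
    ring
  have qD : (1 / (M : ℚ)) + 1 / 2 = ((M + 2 : ℤ) : ℚ) / ((2 * M : ℤ) : ℚ) := by
    have hM0 : (M : ℚ) ≠ 0 := by exact_mod_cast (show M ≠ 0 by omega)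
    rw [div_add_div _ _ hM0 two_ne_zero, div_eq_div_iff (mul_ne_zero hM0 two_ne_zero) (by positivity)]
    push_cast
    ring
  -- (R1) three-term relations at `r = ½` and `r = 0`
  have hW2 := modularSymbol_atkinLehnerW_smul h4 hcop hε (1 / 2 : ℚ) (by positivity)
  have hW0 := modularSymbol_atkinLehnerW_smul h4 hcop hε (0 : ℚ) (by positivity)
  rw [qW2, qxM] at hW2
  rw [qW0, qxM] at hW0
  -- HALF-TRANSLATE at `0`, `¼`, `1/M`
  have hT0 : modularSymbol f (1 / 2 : ℚ) = -modularSymbol f 0 := by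
    have h := maninLocalTwoThree_modularSymbol_add_half_eq_neg_of_four_dvd f h4 heven 0
    rwa [zero_add] at h
  have hT4 : modularSymbol f (3 / 4 : ℚ) = -modularSymbol f (1 / 4 : ℚ) := by
    have h := maninLocalTwoThree_modularSymbol_add_half_eq_neg_of_four_dvd f h4 heven (1 / 4 : ℚ)
    rwa [show (1 / 4 : ℚ) + 1 / 2 = 3 / 4 by norm_num] at h
  have hTM : modularSymbol f (((M + 2 : ℤ) : ℚ) / ((2 * M : ℤ) : ℚ)) = -modularSymbol f (1 / (M : ℚ)) := by
    have h := maninLocalTwoThree_modularSymbol_add_half_eq_neg_of_four_dvd f h4 heven (1 / (M : ℚ))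
    rwa [qD] at h
  rw [q2] at hT0 hW2
  rw [q4, q34] at hT4
  rw [qM] at hTM
  rw [q2, q4, qM, q2M]
  -- names
  set sM := modularSymbol f (((1 : ℤ) : ℚ) / ((M : ℤ) : ℚ)) with hsM
  set s0 := modularSymbol f 0 with hs0
  set s2 := modularSymbol f (((1 : ℤ) : ℚ) / ((2 : ℤ) : ℚ)) with hs2
  set s4 := modularSymbol f (((1 : ℤ) : ℚ) / ((4 : ℤ) : ℚ)) with hs4
  set s2M := modularSymbol f (((1 : ℤ) : ℚ) / ((2 * M : ℤ) : ℚ)) with hs2M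
  set u := modularSymbol f (((x : ℤ) : ℚ) / ((M : ℤ) : ℚ)) with hu
  set A := modularSymbol f (((2 * x + y : ℤ) : ℚ) / ((2 * M + 4 : ℤ) : ℚ)) with hA
  set B := modularSymbol f (((y : ℤ) : ℚ) / ((4 : ℤ) : ℚ)) with hB
  set C := modularSymbol f (((3 : ℤ) : ℚ) / ((4 : ℤ) : ℚ)) with hC
  set D := modularSymbol f (((M + 2 : ℤ) : ℚ) / ((2 * M : ℤ) : ℚ)) with hD
  have hs0' : s0 = modularSymbol f (((0 : ℤ) : ℚ) / ((1 : ℤ) : ℚ)) := by rw [hs0]; norm_num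
  -- the five explicit `Γ₀(4M)`-equivalences
  -- γ₁ : 1/M ↦ x/M
  have l1 : u - sM ∈ periodLattice f :=
    modularSymbol_div_sub_div_mem_periodLattice f (a := x - M * y * (1 + 3 * x)) (b := y * (1 + 3 * x))
      (c := -12 * M * x) (d := 1 + 12 * x) (by linear_combination (1 + 3 * x) * hbez)
      ⟨-3 * x, by rw [hN]; ring⟩ 1 M x M hMne hMne (by ring_nf; exact hMne) (by ring)
  -- γ₂ : ½ ↦ w(½) = (2x + y)/(2M + 4)
  have l2 : A - s2 ∈ periodLattice f :=
    modularSymbol_div_sub_div_mem_periodLattice f (a := (2 * M + 6) * x - 1) (b := y' + 1 - (M + 2) * x)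
      (c := 4 * M * (m' + 2)) (d := 2 - 2 * M - M ^ 2)
      (by rw [hMz]; linear_combination (4 + 2 * (m' : ℤ)) * hbez') ⟨(m' : ℤ) + 2, by rw [hN]⟩
      1 2 (2 * x + y) (2 * M + 4) two_ne_zero (by omega) (by rw [hMz]; nlinarith) (by rw [hy', hMz]; ring)
  -- γ₃ : ¼ ↦ w(0) = y/4
  have l3 : B - s4 ∈ periodLattice f :=
    modularSymbol_div_sub_div_mem_periodLattice f
      (a := y - 4 * (y' * (2 * m' ^ 2 + 2 * m' + 1 + M ^ 2 * y'))) (b := y' * (2 * m' ^ 2 + 2 * m' + 1 + M ^ 2 * y'))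
      (c := 4 * M ^ 2 * (1 - y)) (d := 1 - M ^ 2 * (1 - y)) (by rw [hMz, hy']; ring)
      ⟨(M : ℤ) * (1 - y), by rw [hN]; ring⟩ 1 4 y 4 (by norm_num) (by norm_num) (by ring_nf; norm_num) (by ring)
  -- γ₄ : ¼ ↦ ¾
  have l4 : C - s4 ∈ periodLattice f :=
    modularSymbol_div_sub_div_mem_periodLattice f (a := 6 * M + 1) (b := -3 * m' - 1) (c := 8 * M)
      (d := 1 - 2 * M) (by rw [hMz]; ring) ⟨2, by rw [hN]; ring⟩ 1 4 3 4 (by norm_num) (by norm_num)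
      (by ring_nf; norm_num) (by rw [hMz]; ring)
  -- γ₅ : 1/(2M) ↦ (M+2)/(2M)
  have l5 : D - s2M ∈ periodLattice f :=
    modularSymbol_div_sub_div_mem_periodLattice f (a := M + 2 - 2 * M * (m' + 1) ^ 2) (b := (m' + 1) ^ 2)
      (c := -(4 * M * (m' * (m' + 1)))) (d := 1 + 2 * (m' * (m' + 1))) (by rw [hMz]; ring)
      ⟨-((m' : ℤ) * (m' + 1)), by rw [hN]; ring⟩ 1 (2 * M) (M + 2) (2 * M) (by omega) (by omega)
      (by ring_nf; omega) (by ring)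
  -- bookkeeping
  have h2x : ∀ {z : ℂ}, z ∈ periodLattice f → (2 : ℂ) * z ∈ periodLattice f := fun hz ↦ by
    rw [show (2 : ℂ) = ((2 : ℕ) : ℂ) by norm_num, ← nsmul_eq_mul]; exact AddSubgroup.nsmul_mem _ hz 2
  have h3x : ∀ {z : ℂ}, z ∈ periodLattice f → (3 : ℂ) * z ∈ periodLattice f := fun hz ↦ by
    rw [show (3 : ℂ) = ((3 : ℕ) : ℂ) by norm_num, ← nsmul_eq_mul]; exact AddSubgroup.nsmul_mem _ hz 3
  rw [hs0'] at hW0 hT0 ⊢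
  set s0'' := modularSymbol f (((0 : ℤ) : ℚ) / ((1 : ℤ) : ℚ)) with hs0''
  refine ⟨?_, ?_, ?_, ?_, ?_⟩
  · -- (i)
    have e : (2 : ℂ) * s4 = -(C - s4) := by linear_combination hT4
    rw [e]; exact neg_mem l4
  · -- (ii)
    rcases hε1 with rfl | rfl
    · have e : (3 : ℂ) * sM = 3 * (A - s2) - 3 * (u - sM) := by linear_combination (-3 : ℂ) * hW2
      rw [e]; exact sub_mem (h3x l2) (h3x l1)
    · have e : (3 : ℂ) * sM = (A - s2) - 3 * (u - sM) - (C - s4) + 2 * (B - s4) := by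
        linear_combination (-1 : ℂ) * hW2 - 2 * hW0 + 2 * hT0 + hT4
      rw [e]; exact add_mem (sub_mem (sub_mem l2 (h3x l1)) l4) (h2x l3)
  · -- (iii)
    rcases hε1 with rfl | rfl
    · have e : s0'' - s4 - sM = (u - sM) + (B - s4) - 2 * (A - s2) := by
        linear_combination (2 : ℂ) * hW2 - hW0
      rw [e]; exact sub_mem (add_mem l1 l3) (h2x l2)
    · have e : s0'' - s4 - sM = (C - s4) - (B - s4) + (u - sM) := by linear_combination hW0 - hT4
      rw [e]; exact add_mem (sub_mem l4 l3) l1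
  · -- (iv)
    have e : s2 + s0'' = 0 := by linear_combination hT0
    rw [e]; exact zero_mem _
  · -- (v)
    have e : s2M + sM = -(D - s2M) := by linear_combination hTM
    rw [e]; exact neg_mem l5


/-- **E-an-45 holds: `CuspThreeTorsionAtFourExact`** — for a newform `f` on `Γ₀(4M)`, `M` odd (the leaf's literal
even-coefficient clause is unused: it follows from newness at `4 ∣ N`): `3{∞, 1/M}_f ∈ Λ_f` and
`{∞, 1/(2M)}_f + {∞, 1/M}_f ∈ Λ_f`.  The cell's row (an g11, MEMO-an §55.2; refuter-1 §R46 SURVIVES) was NOT located in print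
as a statement; proved here for either Atkin–Lehner sign. [cite: Manin1972, Prop. 1.4] [cite: Knapp1993, Thm. 9.27] -/
theorem cuspThreeTorsionAtFourExact_holds : CuspThreeTorsionAtFourExact := by
  intro M _ hM f hf _
  obtain ⟨-, h3, -, -, h5⟩ := cusp_relations_of_isNewform0_four_mul hM f hf
  exact ⟨h3, h5⟩

/-- **E-an-45′ holds: `CuspImageThreeTorsion`** — under every `X₀(4M)`-parametrisation (`M` odd) the cusp `1/M` maps to a
point killed by `3` (the leaf's proved edge `cuspImage_three_torsion_of_symbol` over E-an-45). -/
theorem cuspImageThreeTorsion_holds : CuspImageThreeTorsion :=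
  fun _ _ M _ hM D ↦ cuspImage_three_torsion_of_symbol D
    (cuspThreeTorsionAtFourExact_holds hM D.f D.isNewformOf.1 fun _ hn ↦
      Literature.NumberTheory.Automorphic.IsNewform0.cuspCoeff_eq_zero_of_two_dvd D.isNewformOf.1
        (dvd_mul_right 4 M) hn).1

/-- **E-an-83 holds: `FourPCuspHexagon` (THEOREM B of MEMO-an §60.5)** — for the newform of an elliptic curve of conductor
`4p`, `p` an odd prime: `2{∞,¼}`, `3{∞,1/p}`, `{∞,0} − {∞,¼} − {∞,1/p}`, `{∞,½} + {∞,0}`, `{∞,1/(2p)} + {∞,1/p}` all lie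
in `Λ_f`.  No optimality, no parity hypothesis; either sign `λ₄`. [cite: Manin1972, Prop. 1.4] [cite: Knapp1993, Lemma 9.24 and Thm. 9.27] -/
theorem fourPCuspHexagon_holds : FourPCuspHexagon := by
  intro W _ N _ D p hp hp2 hN
  subst hN
  exact cusp_relations_of_isNewform0_four_mul (hp.odd_of_ne_two hp2) D.f D.isNewformOf.1

end Summit.BirchSwinnertonDyer.BirchSwinnertonDyer.Theorems.ManinLocalTwoThree

end
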